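import Summits.QuantumFields.BalabanUV.Beta.GAN24.Push4Oscillation
import Summits.QuantumFields.BalabanUV.Beta.GAN24.Push4Frozen

/-!
# `BalabanUV.Beta.GAN24.Push4Irr` — binder row G-an2-4 / (CONV-C), W-slot road «W3», ROW W3-F3b (T-irr) (gan24-p1-g5 `SKELETON-W3.md` v1.0.2 §8.6
# (F3-core-b) `push₄_locStencil₂_of_zff`; journal INTENT «W3-TIRR*» l.7944), core part 5b = THE CORE (part 5a = `GAN24/Push4Oscillation`): **the four-leg push of a jointly `Lc`-covariant
# `LocStencil₂` table with vanishing field–field zero mode through block-smooth (N1)∕(N1′)-type legs GAINS ONE FACTOR `L⁻¹`** —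
# `LocStencil₂ (push₄ l r X) (cIrr · a³·a′·C·L^{d+1}) (κ₀/(6(d+1)))` with `a = A·(L^{d+2})⁻¹` (sup), `a′ = A′·(L^{d+3})⁻¹` (unit gradient)

NOT IN PRINT; OUR PROOF ATTEMPT (the analytic core of ROW W3-F3b; [folklore] real analysis over leaf-17's `Push4` carrier, leaf-02's `zmode`, and parts 1–4
`LatticeFreeze` ∕ `EnvelopeBlockSum` ∕ `Push4Slices` ∕ `Push4Frozen`; ONE plumbing `def` (`cIrr`, the displayed constant) asserting nothing; 0 cited facts,
0 `def … : Prop`, 0 wall binders).  HONEST FRAMING (cell contract, verbatim): «discharging `BetaPertH` makes Bałaban's UV stability UNCONDITIONAL — a real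
constructive-QFT result; it is NOT the continuum limit and NOT the Clay problem.»  HONEST DEPENDENCY (verbatim): «continuum YM on T⁴ ⇐ BetaPertH ∧ nine spine
estimates (0/9 proved); BetaPertH ⇐ (D1) ∧ (D4) ∧ CAP+tail; G-an2-4 gates asym, D1 and NE2/3/4.»  THIS IS NOT THE ROW: the row (T-irr) = this core ∘ the first
general step (R14-7) ∘ `Push4Nest` ∘ `RespStepSemigroup` ∘ `RespStepDecay` ∘ arithmetic; discharges NOTHING of «T2Shape» ∕ «T2SupRate» ∕ (hW₂, hW₂all);
NOT «W-slot closed», NEVER «G-an2-4 closed»; NOT `BetaPertH`, NOT continuum, NOT Clay.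

## The mechanism (SKELETON-W3 §7.3 (T-irr), (N-F3b))
Read the push with the first table bond `u` outermost (`Push4Slices.push₄_eq_vertexW_push₃`).  For each `u`, freeze the three inner legs at `u`
(`Push4Frozen.abs_push₃_sub_frozen_le`): the remainder carries one Lipschitz allowance `a′` (= one `L⁻¹`); the frozen term is `Λ(u)·S(u)` with `Λ` the product
of the four legs at `u` and `S(u) = sliceSum X κ u …` the slice charge — `Lc`-PERIODIC by joint covariance and of ZERO CELL SUM by `zmode = 0`.  A weight against a
periodic zero-mean function only sees its CELL OSCILLATION (`BiStencilZeroMode.tsum_mul_periodic`): `Σ'_u Λ·S = Σ_{b ∈ cell} S(b)·Σ'_t (Λ(Lc•t + b) − Λ(Lc•t))`,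
and the oscillation of a product of four block-smooth legs over one `Lc`-cell costs one unit-gradient allowance `a′` times `(d+1)·Lc` steps.  The one free block
sum of the four envelopes is `L^{d+1}` (`EnvelopeBlockSum.tsum_env4_le`), with the output decay.

## What is proved (generic `d`; `L ≥ 1` the relative blocking of the legs, `Lc ≥ 1` the period of the table)
(§1–§3 = part 5a `GAN24/Push4Oscillation`: relative-form leg envelopes, cell oscillation of the four-leg product, sublattice sum, the oscillation step.)
* §4 `cIrr` and **`push₄_locStencil₂_of_zff`** — THE CORE (F3-core-b), abstract amplitudes `a, a′`; **`push₄_locStencil₂_of_zff_env`** — the same in §8.6's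
  literal LegEnv∕LegGrad currency `A·((L^{d+2})⁻¹)`, `A′·((L^{d+3})⁻¹)`: constant `cIrr·A³·A′·C·L^{d+1}·((L^{d+2})⁻¹)³·(L^{d+3})⁻¹` — net `L^{−3d−7}·L⁻¹`.
Unit `b2b-balaban-gan24-formalise-leaf-12` (G-an2-4 formalisation swarm, leaf prover 12, gen 20; ROW W3-F3b holder), 2026-08-20.
-/

noncomputable section

open Finset
open scoped BigOperators
open Literature.MathematicalPhysics.QuantumFieldTheory
open Literature.MathematicalPhysics.QuantumFieldTheory.LatticeForm (quo)
open Literature.MathematicalPhysics.QuantumFieldTheory.Balaban1983to89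
open Literature.MathematicalPhysics.QuantumFieldTheory.Balaban1983to89.Beta
open B4ContourShift (supNorm abs_le_supNorm supNorm_nonneg exists_supNorm_eq)
open B12Sec2to5 (l1 l1_nonneg)
open ExpKernelCalculus (MKer comp Zl Zl_nonneg Zl_pos summable_exp_shift summable_exp_shift' tsum_exp_shift tsum_exp_shift' l1_sub_triangle l1_sub_symm shiftK
  BiLoc)
open OneStepResolventKernel (Fib)
open BalabanCompositeJets (LocStencil₂ LocStencil₂.nonneg)
open AffineAveraging (box toSite)
open InterLevelTransport (sublattice_injective)
open Summit.QuantumFields.BalabanUV.Beta.GAN24.Push4 (vertexW vertexW_apply push₄ push₄_def ffRead_inr_left ffRead_inr_right)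
open Summit.QuantumFields.BalabanUV.Beta.GAN24.Push4Slices (push₃ sliceSum push₄_inl_inl_eq_tsum sliceSum_add_zsmul zmode_inl_inl_eq_sum_sliceSum
  abs_sliceSum_le)
open Summit.QuantumFields.BalabanUV.Beta.GAN24.Push4FrozenLayers (summable_of_abs_le_exp abs_tsum_le_of_abs_le_exp abs_base_le)
open Summit.QuantumFields.BalabanUV.Beta.GAN24.Push4Frozen (abs_push₃_sub_frozen_le)
open Summit.QuantumFields.BalabanUV.Beta.GAN24.BiStencilZeroMode (Tab zmode tsum_eq_sum_box_tsum tsum_mul_periodic)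
open Summit.QuantumFields.BalabanUV.Beta.GAN24.LatticeFreeze (abs_sub_le_of_unit_steps)
open Summit.QuantumFields.BalabanUV.Beta.GAN24.EnvelopeBlockSum (env_wobble env_le_one summable_env tsum_env4_le)

open Summit.QuantumFields.BalabanUV.Beta.GAN24.Push4Oscillation (leg_rel_sup leg_rel_lip leg_abs_le summable_leg abs_legs4_sub_le l1_toSite_le env4
  tsum_env4_sublattice_le abs_tsum_mul_periodic_zero_le)

namespace Summit.QuantumFields.BalabanUV.Beta.GAN24.Push4Irr

variable {d : ℕ}

/-! ## §4 The core (F3-core-b) -/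

/-- [folklore] **THE DISPLAYED CONSTANT of (F3-core-b)** (free of `L`, of the legs' amplitudes and of the table's constant):
`cIrr d δ κ₀ Lc = Zl(κ₀/(2(d+1))) · [ (d+1)⁴·M₁·(Zl₁² + Zl₁·Zl δ + (Zl δ)²) + 4·(d+1)⁵·Lc·e^{8κ₀(d+1)Lc}·(Zl δ)³ ]`, `Zl₁ = Zl(δ−κ₀)`,
`M₁ = (2/(δ−κ₀))·Zl((δ−κ₀)/2)` (all `Zl` on `ℤ^{d+1}`).  A definition asserting nothing. -/
def cIrr (d : ℕ) (δ κ₀ : ℝ) (Lc : ℕ) : ℝ :=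
  Zl (d + 1) (κ₀ / (2 * ((d : ℝ) + 1))) *
    ((((d : ℝ) + 1) ^ 4 * (2 / (δ - κ₀) * Zl (d + 1) ((δ - κ₀) / 2)) *
        (Zl (d + 1) (δ - κ₀) * Zl (d + 1) (δ - κ₀) + Zl (d + 1) (δ - κ₀) * Zl (d + 1) δ + Zl (d + 1) δ * Zl (d + 1) δ))
      + 4 * ((d : ℝ) + 1) ^ 5 * Lc * Real.exp (8 * κ₀ * (((d : ℝ) + 1) * Lc)) * (Zl (d + 1) δ * Zl (d + 1) δ * Zl (d + 1) δ))

/-- [folklore] `cIrr ≥ 0` for `0 < κ₀ < δ`. -/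
theorem cIrr_nonneg {δ κ₀ : ℝ} (hκ : 0 < κ₀) (hκδ : κ₀ < δ) (Lc : ℕ) : 0 ≤ cIrr d δ κ₀ Lc := by
  have h1 := sub_pos.2 hκδ
  have hδ : 0 < δ := hκ.trans hκδ
  have := Zl_nonneg (D := d + 1) h1; have := Zl_nonneg (D := d + 1) (half_pos h1); have := Zl_nonneg (D := d + 1) hδ
  have : 0 ≤ Zl (d + 1) (κ₀ / (2 * ((d : ℝ) + 1))) := Zl_nonneg (by positivity)
  unfold cIrr
  positivity

/-- [folklore] **THE FROZEN TERM** of the slice `(κ, u)`: the three inner legs at `u` against the slice charge, summed over the three inner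
direction indices — `frozen4 l r X κ u ν y′ α x′ β z′ := Σ_{κ₂} Σ_{κ₁} Σ_{κ′} r β z′ κ₂ u·(l α x′ κ₁ u·(r ν y′ κ′ u·sliceSum X κ u κ′ κ₁ κ₂))`.
A definition asserting nothing. -/
def frozen4 (l r : Fin (d + 1) → (Fin (d + 1) → ℤ) → Fin (d + 1) → (Fin (d + 1) → ℤ) → ℝ) (X : Tab d)
    (κ : Fin (d + 1)) (u : Fin (d + 1) → ℤ) (ν : Fin (d + 1)) (y' : Fin (d + 1) → ℤ) (α : Fin (d + 1)) (x' : Fin (d + 1) → ℤ)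
    (β : Fin (d + 1)) (z' : Fin (d + 1) → ℤ) : ℝ :=
  ∑ κ₂, ∑ κ₁, ∑ κ', r β z' κ₂ u * (l α x' κ₁ u * (r ν y' κ' u * sliceSum X κ u κ' κ₁ κ₂))

section Core

variable {l r : Fin (d + 1) → (Fin (d + 1) → ℤ) → Fin (d + 1) → (Fin (d + 1) → ℤ) → ℝ} {X : Tab d} {L Lc : ℕ} {C δ κ₀ a a' : ℝ}
  (hL : 1 ≤ L) (hκ : 0 < κ₀) (hκδ : κ₀ < δ) (ha : 0 ≤ a) (ha' : 0 ≤ a')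
  (hl : ∀ α x' κ x, |l α x' κ x| ≤ a * Real.exp (-(κ₀ * supNorm (quo L x - x'))))
  (hr : ∀ μ z κ u, |r μ z κ u| ≤ a * Real.exp (-(κ₀ * supNorm (quo L u - z))))
  (hl' : ∀ α x' κ x i, |l α x' κ (x + Pi.single i 1) - l α x' κ x| ≤ a' * Real.exp (-(κ₀ * supNorm (quo L x - x'))))
  (hr' : ∀ μ z κ u i, |r μ z κ (u + Pi.single i 1) - r μ z κ u| ≤ a' * Real.exp (-(κ₀ * supNorm (quo L u - z))))
  (hX : LocStencil₂ X C δ)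

include hL hκ hκδ ha ha' hl hr hl' hr' hX in
/-- [folklore] **THE FIRST-MOMENT REMAINDER OF ONE SLICE** in envelope currency: `|push₃ − frozen4| ≤ (d+1)³·C·M₁·a²a′·Kz·E_{y′}(u)E_{x′}(u)E_{z′}(u)`
(`Push4Frozen.abs_push₃_sub_frozen_le` with the relative-form allowances of §1). -/
theorem abs_push₃_sub_frozen4_le (κ : Fin (d + 1)) (u : Fin (d + 1) → ℤ) (ν : Fin (d + 1)) (y' : Fin (d + 1) → ℤ) (α : Fin (d + 1))
    (x' : Fin (d + 1) → ℤ) (β : Fin (d + 1)) (z' : Fin (d + 1) → ℤ) :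
    |push₃ l r (X κ u) ν y' x' z' (Sum.inl α) (Sum.inl β) - frozen4 l r X κ u ν y' α x' β z'|
      ≤ ((d + 1 : ℕ) : ℝ) ^ 3 * C * (2 / (δ - κ₀) * Zl (d + 1) ((δ - κ₀) / 2)) * (a ^ 2 * a' *
          (Zl (d + 1) (δ - κ₀) * Zl (d + 1) (δ - κ₀) + Zl (d + 1) (δ - κ₀) * Zl (d + 1) δ + Zl (d + 1) δ * Zl (d + 1) δ)) *
        (Real.exp (-(κ₀ * supNorm (quo L u - y'))) * Real.exp (-(κ₀ * supNorm (quo L u - x'))) * Real.exp (-(κ₀ * supNorm (quo L u - z')))) := by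
  have hκ0 := hκ.le
  have hδ : 0 < δ := hκ.trans hκδ
  have h := abs_push₃_sub_frozen_le (κ := κ) (u := u) (ν := ν) (y' := y') (α := α) (x' := x') (β := β) (z' := z') hX hδ hκ0 hκδ
    (p₁ := a * Real.exp (-(κ₀ * supNorm (quo L u - y')))) (q₁ := a' * Real.exp (-(κ₀ * supNorm (quo L u - y'))))
    (p₂ := a * Real.exp (-(κ₀ * supNorm (quo L u - x')))) (q₂ := a' * Real.exp (-(κ₀ * supNorm (quo L u - x'))))
    (p₃ := a * Real.exp (-(κ₀ * supNorm (quo L u - z')))) (q₃ := a' * Real.exp (-(κ₀ * supNorm (quo L u - z'))))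
    (by positivity) (by positivity) (by positivity) (by positivity) (by positivity) (by positivity)
    (fun κ' v => leg_rel_sup hL hκ0 ha hr ν y' κ' u v) (fun κ' v => leg_rel_lip hL hκ0 ha' hr' ν y' κ' u v)
    (fun κ₁ x => leg_rel_sup hL hκ0 ha hl α x' κ₁ u x) (fun κ₁ x => leg_rel_lip hL hκ0 ha' hl' α x' κ₁ u x)
    (fun κ₂ z => leg_rel_sup hL hκ0 ha hr β z' κ₂ u z) (fun κ₂ z => leg_rel_lip hL hκ0 ha' hr' β z' κ₂ u z)
  refine h.trans (le_of_eq ?_)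
  ring

include hL hκ hκδ ha ha' hl hr hl' hr' hX in
/-- [folklore] **THE REMAINDER PART, SUMMED OVER THE FIRST BOND**: summable, and
`|Σ'_u r μ y κ u·(push₃ − frozen4)| ≤ a·(d+1)³·C·M₁·a²a′·Kz · L^{d+1}·Zl(κ₀/(2(d+1)))·e^{−(κ₀/6)·spread}` (`EnvelopeBlockSum.tsum_env4_le`). -/
theorem tsum_rem_part_le (μ : Fin (d + 1)) (y : Fin (d + 1) → ℤ) (κ : Fin (d + 1)) (ν : Fin (d + 1)) (y' : Fin (d + 1) → ℤ)
    (α : Fin (d + 1)) (x' : Fin (d + 1) → ℤ) (β : Fin (d + 1)) (z' : Fin (d + 1) → ℤ) :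
    (Summable fun u => r μ y κ u * (push₃ l r (X κ u) ν y' x' z' (Sum.inl α) (Sum.inl β) - frozen4 l r X κ u ν y' α x' β z')) ∧
    |∑' u, r μ y κ u * (push₃ l r (X κ u) ν y' x' z' (Sum.inl α) (Sum.inl β) - frozen4 l r X κ u ν y' α x' β z')|
      ≤ (a * (((d + 1 : ℕ) : ℝ) ^ 3 * C * (2 / (δ - κ₀) * Zl (d + 1) ((δ - κ₀) / 2)) * (a ^ 2 * a' *
          (Zl (d + 1) (δ - κ₀) * Zl (d + 1) (δ - κ₀) + Zl (d + 1) (δ - κ₀) * Zl (d + 1) δ + Zl (d + 1) δ * Zl (d + 1) δ)))) *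
        ((L : ℝ) ^ (d + 1) * Zl (d + 1) (κ₀ / (2 * ((d : ℝ) + 1))) *
          Real.exp (-(κ₀ / 6) * (supNorm (y' - y) + supNorm (x' - y) + supNorm (z' - y)))) := by
  have hκ0 := hκ.le
  have hδ : 0 < δ := hκ.trans hκδ
  have hC : 0 ≤ C := hX.nonneg
  have h1 := sub_pos.2 hκδ
  have hZ1 := Zl_nonneg (D := d + 1) h1; have hZh := Zl_nonneg (D := d + 1) (half_pos h1); have hZδ := Zl_nonneg (D := d + 1) hδ
  have hE4 := tsum_env4_le (d := d) hL hκ y y' x' z'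
  set Q : ℝ := ((d + 1 : ℕ) : ℝ) ^ 3 * C * (2 / (δ - κ₀) * Zl (d + 1) ((δ - κ₀) / 2)) * (a ^ 2 * a' *
    (Zl (d + 1) (δ - κ₀) * Zl (d + 1) (δ - κ₀) + Zl (d + 1) (δ - κ₀) * Zl (d + 1) δ + Zl (d + 1) δ * Zl (d + 1) δ)) with hQ
  have hQ0 : 0 ≤ Q := by rw [hQ]; positivity
  have hpt : ∀ u, ‖r μ y κ u * (push₃ l r (X κ u) ν y' x' z' (Sum.inl α) (Sum.inl β) - frozen4 l r X κ u ν y' α x' β z')‖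
      ≤ (a * Q) * (Real.exp (-(κ₀ * supNorm (quo L u - y))) * Real.exp (-(κ₀ * supNorm (quo L u - y'))) *
          Real.exp (-(κ₀ * supNorm (quo L u - x'))) * Real.exp (-(κ₀ * supNorm (quo L u - z')))) := by
    intro u
    rw [Real.norm_eq_abs, abs_mul]
    have hrem := abs_push₃_sub_frozen4_le hL hκ hκδ ha ha' hl hr hl' hr' hX κ u ν y' α x' β z'
    calc |r μ y κ u| * |push₃ l r (X κ u) ν y' x' z' (Sum.inl α) (Sum.inl β) - frozen4 l r X κ u ν y' α x' β z'|
        ≤ (a * Real.exp (-(κ₀ * supNorm (quo L u - y)))) * (Q * (Real.exp (-(κ₀ * supNorm (quo L u - y'))) *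
            Real.exp (-(κ₀ * supNorm (quo L u - x'))) * Real.exp (-(κ₀ * supNorm (quo L u - z'))))) :=
          mul_le_mul (hr μ y κ u) (by rw [hQ]; exact hrem) (abs_nonneg _) (by positivity)
      _ = _ := by ring
  have hs := hE4.1.mul_left (a * Q)
  refine ⟨Summable.of_norm_bounded hs hpt, ?_⟩
  have hb := tsum_of_norm_bounded hs.hasSum hpt
  rw [Real.norm_eq_abs, tsum_mul_left] at hb
  exact hb.trans (mul_le_mul_of_nonneg_left hE4.2 (by positivity))

include hL hκ hκδ ha ha' hl hr hl' hr' hX in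
/-- [folklore] **THE FROZEN PART, SUMMED OVER THE FIRST BOND = THE OSCILLATION**: summable, and for a jointly `Lc`-covariant table with `Z_ff = 0`,
`|Σ'_u r μ y κ u·frozen4| ≤ (d+1)³·4a³a′·((d+1)Lc)·e^{8κ₀(d+1)Lc}·C(Zl δ)³ · L^{d+1}·Zl(κ₀/(2(d+1)))·e^{−(κ₀/6)·spread}`. -/
theorem tsum_frozen_part_le [NeZero Lc]
    (hcov : ∀ κ u κ' u' t, X κ (u + (Lc : ℤ) • t) κ' (u' + (Lc : ℤ) • t) = shiftK (-((Lc : ℤ) • t)) (X κ u κ' u'))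
    (hZ : ∀ κ κ' κ₁ κ₂, zmode Lc X κ κ' (Sum.inl κ₁) (Sum.inl κ₂) = 0)
    (μ : Fin (d + 1)) (y : Fin (d + 1) → ℤ) (κ : Fin (d + 1)) (ν : Fin (d + 1)) (y' : Fin (d + 1) → ℤ)
    (α : Fin (d + 1)) (x' : Fin (d + 1) → ℤ) (β : Fin (d + 1)) (z' : Fin (d + 1) → ℤ) :
    (Summable fun u => r μ y κ u * frozen4 l r X κ u ν y' α x' β z') ∧
    |∑' u, r μ y κ u * frozen4 l r X κ u ν y' α x' β z'|
      ≤ ((d + 1 : ℕ) : ℝ) ^ 3 * (4 * a ^ 3 * a' * (((d : ℝ) + 1) * Lc) * Real.exp (8 * κ₀ * (((d : ℝ) + 1) * Lc)) *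
          (C * Zl (d + 1) δ * Zl (d + 1) δ * Zl (d + 1) δ) *
        ((L : ℝ) ^ (d + 1) * Zl (d + 1) (κ₀ / (2 * ((d : ℝ) + 1))) *
          Real.exp (-(κ₀ / 6) * (supNorm (y' - y) + supNorm (x' - y) + supNorm (z' - y))))) := by
  have hκ0 := hκ.le
  have hδ : 0 < δ := hκ.trans hκδ
  have hC : 0 ≤ C := hX.nonneg
  have hZδ := Zl_nonneg (D := d + 1) hδ
  have hlb : ∀ α x' κ x, |l α x' κ x| ≤ a := fun α x' κ x => leg_abs_le hκ0 ha hl α x' κ x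
  have hrb : ∀ μ y κ u, |r μ y κ u| ≤ a := fun μ y κ u => leg_abs_le hκ0 ha hr μ y κ u
  have hSb : ∀ u κ' κ₁ κ₂, |sliceSum X κ u κ' κ₁ κ₂| ≤ C * Zl (d + 1) δ * Zl (d + 1) δ * Zl (d + 1) δ :=
    fun u κ' κ₁ κ₂ => (abs_sliceSum_le hX hδ κ u κ' κ₁ κ₂).2
  have hE4 := tsum_env4_le (d := d) hL hκ y y' x' z'
  have hE4s : Summable (env4 L κ₀ y y' x' z') := hE4.1
  set W : ℝ := (L : ℝ) ^ (d + 1) * Zl (d + 1) (κ₀ / (2 * ((d : ℝ) + 1))) *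
    Real.exp (-(κ₀ / 6) * (supNorm (y' - y) + supNorm (x' - y) + supNorm (z' - y))) with hW
  have hE4W : (∑' u : Fin (d + 1) → ℤ, env4 L κ₀ y y' x' z' u) ≤ W := hE4.2
  -- summability of each index term
  have hΛs : ∀ κ₂ κ₁ κ', Summable fun u => r μ y κ u * (r β z' κ₂ u * (l α x' κ₁ u * (r ν y' κ' u * sliceSum X κ u κ' κ₁ κ₂))) := by
    intro κ₂ κ₁ κ'
    refine Summable.of_norm_bounded (((summable_env hL hκ y).mul_left a).mul_right
      (a * (a * (a * (C * Zl (d + 1) δ * Zl (d + 1) δ * Zl (d + 1) δ))))) (fun u => ?_)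
    rw [Real.norm_eq_abs, abs_mul, abs_mul, abs_mul, abs_mul]
    exact mul_le_mul (hr μ y κ u) (mul_le_mul (hrb β z' κ₂ u) (mul_le_mul (hlb α x' κ₁ u) (mul_le_mul (hrb ν y' κ' u)
      (hSb u κ' κ₁ κ₂) (abs_nonneg _) ha) (by positivity) ha) (by positivity) ha) (by positivity) (by positivity)
  have hmul : ∀ u, r μ y κ u * frozen4 l r X κ u ν y' α x' β z'
      = ∑ κ₂, ∑ κ₁, ∑ κ', r μ y κ u * (r β z' κ₂ u * (l α x' κ₁ u * (r ν y' κ' u * sliceSum X κ u κ' κ₁ κ₂))) := by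
    intro u; unfold frozen4; simp_rw [Finset.mul_sum]
  have hsumF : Summable fun u => r μ y κ u * frozen4 l r X κ u ν y' α x' β z' := by
    simp_rw [hmul]
    exact summable_sum fun κ₂ _ => summable_sum fun κ₁ _ => summable_sum fun κ' _ => hΛs κ₂ κ₁ κ'
  refine ⟨hsumF, ?_⟩
  -- move the finite index sums outside the `u`-sum
  have hswap : (∑' u, r μ y κ u * frozen4 l r X κ u ν y' α x' β z')
      = ∑ κ₂, ∑ κ₁, ∑ κ', ∑' u, r μ y κ u * (r β z' κ₂ u * (l α x' κ₁ u * (r ν y' κ' u * sliceSum X κ u κ' κ₁ κ₂))) := by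
    simp_rw [hmul]
    rw [Summable.tsum_finsetSum (fun κ₂ _ => summable_sum fun κ₁ _ => summable_sum fun κ' _ => hΛs κ₂ κ₁ κ')]
    refine Finset.sum_congr rfl fun κ₂ _ => ?_
    rw [Summable.tsum_finsetSum (fun κ₁ _ => summable_sum fun κ' _ => hΛs κ₂ κ₁ κ')]
    refine Finset.sum_congr rfl fun κ₁ _ => ?_
    exact Summable.tsum_finsetSum (fun κ' _ => hΛs κ₂ κ₁ κ')
  rw [hswap]
  have hLcD : ((Lc : ℝ) ^ (d + 1)) * ((Lc : ℝ) ^ (d + 1))⁻¹ = 1 := by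
    have hLc0 : (0 : ℝ) < (Lc : ℝ) := by exact_mod_cast Nat.pos_of_ne_zero (NeZero.ne Lc)
    exact mul_inv_cancel₀ (by positivity)
  have e8 : Real.exp (8 * κ₀ * (((d : ℝ) + 1) * Lc)) = Real.exp (4 * κ₀ * (((d : ℝ) + 1) * Lc)) * Real.exp (4 * κ₀ * (((d : ℝ) + 1) * Lc)) := by
    rw [← Real.exp_add]; congr 1; ring
  have hsub := tsum_env4_sublattice_le (d := d) (Lc := Lc) hκ hL y y' x' z' hE4s
  have htE : ∑' t : Fin (d + 1) → ℤ, env4 L κ₀ y y' x' z' ((Lc : ℤ) • t)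
      ≤ Real.exp (4 * κ₀ * (((d : ℝ) + 1) * Lc)) * ((Lc : ℝ) ^ (d + 1))⁻¹ * W :=
    hsub.2.trans (mul_le_mul_of_nonneg_left hE4W (by positivity))
  -- per index tuple: the oscillation step
  have hosc : ∀ κ₂ κ₁ κ', |∑' u, r μ y κ u * (r β z' κ₂ u * (l α x' κ₁ u * (r ν y' κ' u * sliceSum X κ u κ' κ₁ κ₂)))|
      ≤ 4 * a ^ 3 * a' * (((d : ℝ) + 1) * Lc) * Real.exp (8 * κ₀ * (((d : ℝ) + 1) * Lc)) *
        (C * Zl (d + 1) δ * Zl (d + 1) δ * Zl (d + 1) δ) * W := by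
    intro κ₂ κ₁ κ'
    have e : ∀ u, r μ y κ u * (r β z' κ₂ u * (l α x' κ₁ u * (r ν y' κ' u * sliceSum X κ u κ' κ₁ κ₂)))
        = (r μ y κ u * r ν y' κ' u * l α x' κ₁ u * r β z' κ₂ u) * sliceSum X κ u κ' κ₁ κ₂ := fun u => by ring
    simp_rw [e]
    have hΛ : Summable fun u => r μ y κ u * r ν y' κ' u * l α x' κ₁ u * r β z' κ₂ u := by
      refine Summable.of_norm_bounded (((summable_env hL hκ y).mul_left a).mul_right (a * a * a)) (fun u => ?_)
      rw [Real.norm_eq_abs, abs_mul, abs_mul, abs_mul]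
      have h0 := hr μ y κ u; have h1 := hrb ν y' κ' u; have h2 := hlb α x' κ₁ u; have h3 := hrb β z' κ₂ u
      have := abs_nonneg (r μ y κ u); have := abs_nonneg (r ν y' κ' u); have := abs_nonneg (l α x' κ₁ u)
      calc |r μ y κ u| * |r ν y' κ' u| * |l α x' κ₁ u| * |r β z' κ₂ u|
          ≤ (a * Real.exp (-(κ₀ * supNorm (quo L u - y)))) * a * a * a := by gcongr
        _ = _ := by ring
    have h1 := abs_tsum_mul_periodic_zero_le (Lc := Lc) (E := env4 L κ₀ y y' x' z') hΛ (by positivity) (fun u => hSb u κ' κ₁ κ₂)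
      (fun u t => sliceSum_add_zsmul hcov κ u t κ' κ₁ κ₂) (by rw [← zmode_inl_inl_eq_sum_sliceSum]; exact hZ κ κ' κ₁ κ₂) hsub.1
      (fun b hb t => abs_legs4_sub_le (d := d) hL hκ ha ha' hl hr hl' hr' (ℓ := ((d : ℝ) + 1) * Lc) μ y κ ν y' κ' α x' κ₁ β z' κ₂
        ((Lc : ℤ) • t) (toSite b) (l1_toSite_le hb))
    refine h1.trans ?_
    have h2 : (Lc : ℝ) ^ (d + 1) * (C * Zl (d + 1) δ * Zl (d + 1) δ * Zl (d + 1) δ) *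
        (4 * a ^ 3 * a' * (((d : ℝ) + 1) * Lc) * Real.exp (4 * κ₀ * (((d : ℝ) + 1) * Lc)) *
          ∑' t : Fin (d + 1) → ℤ, env4 L κ₀ y y' x' z' ((Lc : ℤ) • t))
        ≤ (Lc : ℝ) ^ (d + 1) * (C * Zl (d + 1) δ * Zl (d + 1) δ * Zl (d + 1) δ) *
          (4 * a ^ 3 * a' * (((d : ℝ) + 1) * Lc) * Real.exp (4 * κ₀ * (((d : ℝ) + 1) * Lc)) *
            (Real.exp (4 * κ₀ * (((d : ℝ) + 1) * Lc)) * ((Lc : ℝ) ^ (d + 1))⁻¹ * W)) :=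
      mul_le_mul_of_nonneg_left (mul_le_mul_of_nonneg_left htE (by positivity)) (by positivity)
    refine h2.trans (le_of_eq ?_)
    rw [e8]
    calc (Lc : ℝ) ^ (d + 1) * (C * Zl (d + 1) δ * Zl (d + 1) δ * Zl (d + 1) δ) *
          (4 * a ^ 3 * a' * (((d : ℝ) + 1) * Lc) * Real.exp (4 * κ₀ * (((d : ℝ) + 1) * Lc)) *
            (Real.exp (4 * κ₀ * (((d : ℝ) + 1) * Lc)) * ((Lc : ℝ) ^ (d + 1))⁻¹ * W))
        = ((Lc : ℝ) ^ (d + 1) * ((Lc : ℝ) ^ (d + 1))⁻¹) * (4 * a ^ 3 * a' * (((d : ℝ) + 1) * Lc) *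
            (Real.exp (4 * κ₀ * (((d : ℝ) + 1) * Lc)) * Real.exp (4 * κ₀ * (((d : ℝ) + 1) * Lc))) *
            (C * Zl (d + 1) δ * Zl (d + 1) δ * Zl (d + 1) δ) * W) := by ring
      _ = _ := by rw [hLcD, one_mul]
  calc |∑ κ₂, ∑ κ₁, ∑ κ', ∑' u, r μ y κ u * (r β z' κ₂ u * (l α x' κ₁ u * (r ν y' κ' u * sliceSum X κ u κ' κ₁ κ₂)))|
      ≤ ∑ κ₂, |∑ κ₁, ∑ κ', ∑' u, r μ y κ u * (r β z' κ₂ u * (l α x' κ₁ u * (r ν y' κ' u * sliceSum X κ u κ' κ₁ κ₂)))| :=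
        Finset.abs_sum_le_sum_abs _ _
    _ ≤ ∑ κ₂, ∑ κ₁, |∑ κ', ∑' u, r μ y κ u * (r β z' κ₂ u * (l α x' κ₁ u * (r ν y' κ' u * sliceSum X κ u κ' κ₁ κ₂)))| :=
        Finset.sum_le_sum fun κ₂ _ => Finset.abs_sum_le_sum_abs _ _
    _ ≤ ∑ κ₂, ∑ κ₁, ∑ κ', |∑' u, r μ y κ u * (r β z' κ₂ u * (l α x' κ₁ u * (r ν y' κ' u * sliceSum X κ u κ' κ₁ κ₂)))| :=
        Finset.sum_le_sum fun κ₂ _ => Finset.sum_le_sum fun κ₁ _ => Finset.abs_sum_le_sum_abs _ _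
    _ ≤ ∑ _κ₂ : Fin (d + 1), ∑ _κ₁ : Fin (d + 1), ∑ _κ' : Fin (d + 1), 4 * a ^ 3 * a' * (((d : ℝ) + 1) * Lc) *
          Real.exp (8 * κ₀ * (((d : ℝ) + 1) * Lc)) * (C * Zl (d + 1) δ * Zl (d + 1) δ * Zl (d + 1) δ) * W :=
        Finset.sum_le_sum fun κ₂ _ => Finset.sum_le_sum fun κ₁ _ => Finset.sum_le_sum fun κ' _ => hosc κ₂ κ₁ κ'
    _ = _ := by simp only [Finset.sum_const, Finset.card_univ, Fintype.card_fin, nsmul_eq_mul]; push_cast; ring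

include hL hκ hκδ ha ha' hl hr hl' hr' hX in
/-- NOT IN PRINT; OUR PROOF.  **(F3-core-b) — THE FOUR-LEG PUSH OF A ZERO-MODE-FREE, JOINTLY `Lc`-COVARIANT `LocStencil₂` TABLE THROUGH BLOCK-SMOOTH LEGS
GAINS ONE LIPSCHITZ ALLOWANCE** (abstract amplitudes): legs with sup envelope `a·e^{−κ₀‖quo L · − z‖∞}` and unit-gradient envelope `a′·e^{−κ₀‖quo L · − z‖∞}`,
a table with `LocStencil₂ X C δ` (`0 < κ₀ < δ`), jointly `Lc`-covariant, with vanishing field–field zero mode `zmode Lc X κ κ′ (inl κ₁) (inl κ₂) = 0` ⇒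
`LocStencil₂ (push₄ l r X) (cIrr d δ κ₀ Lc · a³ · a′ · C · L^{d+1}) (κ₀/(6(d+1)))`.  Every `a′` is one relative power `L⁻¹` once `a′ = A′·(L^{d+3})⁻¹`
(`push₄_locStencil₂_of_zff_env`). -/
theorem push₄_locStencil₂_of_zff [NeZero Lc]
    (hcov : ∀ κ u κ' u' t, X κ (u + (Lc : ℤ) • t) κ' (u' + (Lc : ℤ) • t) = shiftK (-((Lc : ℤ) • t)) (X κ u κ' u'))
    (hZ : ∀ κ κ' κ₁ κ₂, zmode Lc X κ κ' (Sum.inl κ₁) (Sum.inl κ₂) = 0) :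
    LocStencil₂ (push₄ l r X) (cIrr d δ κ₀ Lc * a ^ 3 * a' * C * (L : ℝ) ^ (d + 1)) (κ₀ / (6 * ((d : ℝ) + 1))) := by
  have hκ0 := hκ.le
  have hδ : 0 < δ := hκ.trans hκδ
  have hC : 0 ≤ C := hX.nonneg
  have hD : (0 : ℝ) < (d : ℝ) + 1 := by positivity
  have hcI := cIrr_nonneg (d := d) hκ hκδ Lc
  intro μ y ν y' x' z' aa bb
  set K : ℝ := cIrr d δ κ₀ Lc * a ^ 3 * a' * C * (L : ℝ) ^ (d + 1) with hK
  have hK0 : 0 ≤ K := by rw [hK]; positivity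
  -- multiplier fibre indices: the push is ff-valued
  rcases aa with α | μ'
  swap
  · rw [push₄_def, ffRead_inr_left, abs_zero]; positivity
  rcases bb with β | ν''
  swap
  · rw [push₄_def, ffRead_inr_right, abs_zero]; positivity
  set S₃ : ℝ := supNorm (y' - y) + supNorm (x' - y) + supNorm (z' - y) with hS₃
  set W : ℝ := (L : ℝ) ^ (d + 1) * Zl (d + 1) (κ₀ / (2 * ((d : ℝ) + 1))) * Real.exp (-(κ₀ / 6) * S₃) with hW
  -- §A. the entry with `u` outermost
  have hls : ∀ α x' κ, Summable fun x => l α x' κ x := fun α x' κ => summable_leg hL hκ hl α x' κ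
  have hrs : ∀ μ y κ, Summable fun u => r μ y κ u := fun μ y κ => summable_leg hL hκ hr μ y κ
  have hlb : ∀ α x' κ x, |l α x' κ x| ≤ a := fun α x' κ x => leg_abs_le hκ0 ha hl α x' κ x
  have hrb : ∀ μ y κ u, |r μ y κ u| ≤ a := fun μ y κ u => leg_abs_le hκ0 ha hr μ y κ u
  rw [push₄_inl_inl_eq_tsum hls hrs hlb hrb ha ha hX hδ]
  -- §B. split each `u`-sum into frozen part + remainder
  have hR := fun κ => tsum_rem_part_le hL hκ hκδ ha ha' hl hr hl' hr' hX μ y κ ν y' α x' β z'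
  have hF := fun κ => tsum_frozen_part_le hL hκ hκδ ha ha' hl hr hl' hr' hX (Lc := Lc) hcov hZ μ y κ ν y' α x' β z'
  have hsplit : ∀ κ, (∑' u, r μ y κ u * push₃ l r (X κ u) ν y' x' z' (Sum.inl α) (Sum.inl β))
      = (∑' u, r μ y κ u * frozen4 l r X κ u ν y' α x' β z')
        + ∑' u, r μ y κ u * (push₃ l r (X κ u) ν y' x' z' (Sum.inl α) (Sum.inl β) - frozen4 l r X κ u ν y' α x' β z') := by
    intro κ
    rw [← (hF κ).1.tsum_add (hR κ).1]
    exact tsum_congr fun u => by ring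
  have htot : |∑ κ, ∑' u, r μ y κ u * push₃ l r (X κ u) ν y' x' z' (Sum.inl α) (Sum.inl β)| ≤ K * Real.exp (-(κ₀ / 6) * S₃) := by
    calc |∑ κ, ∑' u, r μ y κ u * push₃ l r (X κ u) ν y' x' z' (Sum.inl α) (Sum.inl β)|
        ≤ ∑ κ, |∑' u, r μ y κ u * push₃ l r (X κ u) ν y' x' z' (Sum.inl α) (Sum.inl β)| := Finset.abs_sum_le_sum_abs _ _
      _ ≤ ∑ _κ : Fin (d + 1), (((d + 1 : ℕ) : ℝ) ^ 3 * (4 * a ^ 3 * a' * (((d : ℝ) + 1) * Lc) * Real.exp (8 * κ₀ * (((d : ℝ) + 1) * Lc)) *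
            (C * Zl (d + 1) δ * Zl (d + 1) δ * Zl (d + 1) δ) * W)
            + (a * (((d + 1 : ℕ) : ℝ) ^ 3 * C * (2 / (δ - κ₀) * Zl (d + 1) ((δ - κ₀) / 2)) * (a ^ 2 * a' *
              (Zl (d + 1) (δ - κ₀) * Zl (d + 1) (δ - κ₀) + Zl (d + 1) (δ - κ₀) * Zl (d + 1) δ + Zl (d + 1) δ * Zl (d + 1) δ)))) * W) :=
          Finset.sum_le_sum fun κ _ => by
            rw [hsplit κ]
            exact (abs_add_le _ _).trans (add_le_add (by rw [hW, hS₃]; exact (hF κ).2) (by rw [hW, hS₃]; exact (hR κ).2))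
      _ = K * Real.exp (-(κ₀ / 6) * S₃) := by
          rw [Finset.sum_const, Finset.card_univ, Fintype.card_fin, nsmul_eq_mul, hK, cIrr, hW]
          push_cast
          ring
  -- §C. convert the sup-norm decay to the ℓ¹ currency
  have hsupl1 : ∀ v : Fin (d + 1) → ℤ, l1 v ≤ ((d : ℝ) + 1) * supNorm v := fun v => by
    unfold l1
    calc ∑ i, |((v i : ℤ) : ℝ)| ≤ ∑ _i : Fin (d + 1), supNorm v := Finset.sum_le_sum fun i _ => by
            have h := abs_le_supNorm v i; rwa [Int.cast_abs] at h
      _ = ((d : ℝ) + 1) * supNorm v := by rw [Finset.sum_const, Finset.card_univ, Fintype.card_fin, nsmul_eq_mul]; push_cast; ring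
  have hconv : Real.exp (-(κ₀ / 6) * S₃) ≤ Real.exp (-(κ₀ / (6 * ((d : ℝ) + 1))) * l1 (y' - y)) *
      Real.exp (-(κ₀ / (6 * ((d : ℝ) + 1))) * (l1 (x' - y) + l1 (z' - y))) := by
    rw [← Real.exp_add, Real.exp_le_exp, hS₃]
    have h123 : l1 (y' - y) + l1 (x' - y) + l1 (z' - y) ≤ ((d : ℝ) + 1) * (supNorm (y' - y) + supNorm (x' - y) + supNorm (z' - y)) := by
      have := add_le_add (add_le_add (hsupl1 (y' - y)) (hsupl1 (x' - y))) (hsupl1 (z' - y))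
      linarith
    have hk : 0 ≤ κ₀ / (6 * ((d : ℝ) + 1)) := by positivity
    have key := mul_le_mul_of_nonneg_left h123 hk
    have e : κ₀ / (6 * ((d : ℝ) + 1)) * (((d : ℝ) + 1) * (supNorm (y' - y) + supNorm (x' - y) + supNorm (z' - y)))
        = κ₀ / 6 * (supNorm (y' - y) + supNorm (x' - y) + supNorm (z' - y)) := by
      field_simp
    rw [e] at key
    linarith
  calc |∑ κ, ∑' u, r μ y κ u * push₃ l r (X κ u) ν y' x' z' (Sum.inl α) (Sum.inl β)| ≤ K * Real.exp (-(κ₀ / 6) * S₃) := htot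
    _ ≤ K * (Real.exp (-(κ₀ / (6 * ((d : ℝ) + 1))) * l1 (y' - y)) * Real.exp (-(κ₀ / (6 * ((d : ℝ) + 1))) * (l1 (x' - y) + l1 (z' - y)))) :=
        mul_le_mul_of_nonneg_left hconv hK0
    _ = K * Real.exp (-(κ₀ / (6 * ((d : ℝ) + 1))) * l1 (y' - y)) * Real.exp (-(κ₀ / (6 * ((d : ℝ) + 1))) * (l1 (x' - y) + l1 (z' - y))) := by
        ring

/-- NOT IN PRINT; OUR PROOF.  **(F3-core-b) IN THE OWNER'S §8.6 CURRENCY** (SKELETON-W3 v1.0.2): LegEnv `|r μ z κ u| ≤ A·((L^{d+2})⁻¹)·e^{−κ₀‖quo L u − z‖∞}`,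
LegGrad `|r μ z κ (u + e_i) − r μ z κ u| ≤ A′·((L^{d+3})⁻¹)·e^{−κ₀‖quo L u − z‖∞}` (the literal shapes of `RespStepDecay.exists_respStep_decay_and_grad` at
relative blocking `L`), `LocStencil₂ X C δ` with `0 < κ₀ < δ`, joint `Lc`-covariance, `Z_ff X = 0` ⇒
`LocStencil₂ (push₄ l r X) (cIrr d δ κ₀ Lc · A³ · A′ · C · L^{d+1} · ((L^{d+2})⁻¹)³ · (L^{d+3})⁻¹) (κ₀/(6(d+1)))` — the four-leg count `L^{d+1−4(d+2)}` of
(T-marg) times ONE MORE `L⁻¹`. -/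
theorem push₄_locStencil₂_of_zff_env [NeZero Lc] {A A' : ℝ} (hL : 1 ≤ L) (hκ : 0 < κ₀) (hκδ : κ₀ < δ) (hA : 0 ≤ A) (hA' : 0 ≤ A')
    (hl : ∀ α x' κ x, |l α x' κ x| ≤ A * (((L : ℕ) : ℝ) ^ (d + 2))⁻¹ * Real.exp (-(κ₀ * supNorm (quo L x - x'))))
    (hr : ∀ μ z κ u, |r μ z κ u| ≤ A * (((L : ℕ) : ℝ) ^ (d + 2))⁻¹ * Real.exp (-(κ₀ * supNorm (quo L u - z))))
    (hl' : ∀ α x' κ x i, |l α x' κ (x + Pi.single i 1) - l α x' κ x| ≤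
      A' * (((L : ℕ) : ℝ) ^ (d + 3))⁻¹ * Real.exp (-(κ₀ * supNorm (quo L x - x'))))
    (hr' : ∀ μ z κ u i, |r μ z κ (u + Pi.single i 1) - r μ z κ u| ≤
      A' * (((L : ℕ) : ℝ) ^ (d + 3))⁻¹ * Real.exp (-(κ₀ * supNorm (quo L u - z))))
    (hX : LocStencil₂ X C δ)
    (hcov : ∀ κ u κ' u' t, X κ (u + (Lc : ℤ) • t) κ' (u' + (Lc : ℤ) • t) = shiftK (-((Lc : ℤ) • t)) (X κ u κ' u'))
    (hZ : ∀ κ κ' κ₁ κ₂, zmode Lc X κ κ' (Sum.inl κ₁) (Sum.inl κ₂) = 0) :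
    LocStencil₂ (push₄ l r X)
      (cIrr d δ κ₀ Lc * A ^ 3 * A' * C * (L : ℝ) ^ (d + 1) * ((((L : ℕ) : ℝ) ^ (d + 2))⁻¹) ^ 3 * (((L : ℕ) : ℝ) ^ (d + 3))⁻¹)
      (κ₀ / (6 * ((d : ℝ) + 1))) := by
  have hL0 : (0 : ℝ) < ((L : ℕ) : ℝ) := by exact_mod_cast hL
  have h := push₄_locStencil₂_of_zff (a := A * (((L : ℕ) : ℝ) ^ (d + 2))⁻¹) (a' := A' * (((L : ℕ) : ℝ) ^ (d + 3))⁻¹)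
    hL hκ hκδ (by positivity) (by positivity) hl hr hl' hr' hX hcov hZ
  have e : cIrr d δ κ₀ Lc * (A * (((L : ℕ) : ℝ) ^ (d + 2))⁻¹) ^ 3 * (A' * (((L : ℕ) : ℝ) ^ (d + 3))⁻¹) * C * (L : ℝ) ^ (d + 1)
      = cIrr d δ κ₀ Lc * A ^ 3 * A' * C * (L : ℝ) ^ (d + 1) * ((((L : ℕ) : ℝ) ^ (d + 2))⁻¹) ^ 3 * (((L : ℕ) : ℝ) ^ (d + 3))⁻¹ := by ring
  rw [e] at h
  exact h

end Core

end Summit.QuantumFields.BalabanUV.Beta.GAN24.Push4Irr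

end
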